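import Summits.RiemannHypothesis.RiemannHypothesis.Theorems.HardyZLehmerSplitDictionaryFarFieldShells
import HarnessLib

/-!
# Upper and lower shell bounds for stub B of crux `Dictionary`

This file continues `HardyZLehmerSplitDictionaryFarFieldShells.lean` with the upper-range
(`γ > t + 1`) and lower-range (`0 ≤ γ ≤ t − 1`) shell bounds:
- `finset_sum_above_le`: zeros with `γ > t + 1` contribute `≤ 9 log t + 45`
- `finset_sum_below_le`: zeros with `0 ≤ γ ≤ t − 1` contribute `≤ 9 log t`

Nothing here bears on the truth of RH.
-/

noncomputable section

open Complex Set Filter Topology Real BigOperators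
open Literature.NumberTheory.LFunctions
open Summit.RiemannHypothesis.RiemannHypothesis.Theorems

namespace StubFarField

/-! ## Upper range `γ > t + 1`: ceiling shells -/

/-- Upper shell index `⌈γ − t⌉₊ − 1`: for `γ > t + 1` it is `≥ 1` and pins `t + n < γ ≤ t + n + 1`. -/
def shellUp (t : ℝ) (ρ : Zeros) : ℕ := ⌈(ρ : ℂ).im - t⌉₊ - 1

/-- For zeros with `γ > t + 1`, the upper shell index is `≥ 1` and satisfies `t + n < γ ≤ t + n + 1`. -/
lemma shellUp_spec {t : ℝ} {ρ : Zeros} (h : t + 1 < (ρ : ℂ).im) :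
    1 ≤ shellUp t ρ ∧ t + shellUp t ρ < (ρ : ℂ).im ∧ (ρ : ℂ).im ≤ t + shellUp t ρ + 1 := by
  have hx1 : 1 < (ρ : ℂ).im - t := by linarith
  have hx0 : 0 ≤ (ρ : ℂ).im - t := by linarith
  have hle := Nat.le_ceil ((ρ : ℂ).im - t)
  have hlt := Nat.ceil_lt_add_one hx0
  have h2 : 2 ≤ ⌈(ρ : ℂ).im - t⌉₊ := by
    have h1 : (1 : ℝ) < (⌈(ρ : ℂ).im - t⌉₊ : ℝ) := lt_of_lt_of_le hx1 hle
    have h1' : 1 < ⌈(ρ : ℂ).im - t⌉₊ := by exact_mod_cast h1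
    omega
  have hcast : ((shellUp t ρ : ℕ) : ℝ) = (⌈(ρ : ℂ).im - t⌉₊ : ℝ) - 1 := by
    unfold shellUp
    rw [Nat.cast_sub (by omega), Nat.cast_one]
  refine ⟨?_, ?_, ?_⟩
  · unfold shellUp; omega
  · rw [hcast]; linarith
  · rw [hcast]; linarith

/-- Kernel bound on an upper shell: `|K| ≤ (3/2)/(shellUp)²`. -/
lemma kernel_shellUp_bound {t : ℝ} {ρ : Zeros} (h : t + 1 < (ρ : ℂ).im) :
    |kernel t ρ| ≤ 3 / 2 / (shellUp t ρ : ℝ) ^ 2 := by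
  obtain ⟨h1, hlo, -⟩ := shellUp_spec h
  have hn1 : (1 : ℝ) ≤ shellUp t ρ := by exact_mod_cast h1
  have habs : |t - (ρ : ℂ).im| = (ρ : ℂ).im - t := by
    rw [abs_sub_comm]; exact abs_of_pos (by linarith)
  have hge : 1 ≤ |t - (ρ : ℂ).im| := by rw [habs]; linarith
  have hk := abs_kernel_le hge
  have hsq : (shellUp t ρ : ℝ) ^ 2 ≤ (t - (ρ : ℂ).im) ^ 2 := by nlinarith
  exact hk.trans (div_le_div_of_nonneg_left (by norm_num) (by positivity) hsq)

/-- **Upper-range shell bound**: `∑_S |farTerm| ≤ 9 log t + 45` when every `γ > t + 1`. -/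
lemma finset_sum_above_le {t : ℝ} (ht : 100 ≤ t) (S : Finset Zeros)
    (hS : ∀ ρ ∈ S, (ρ : ℂ) ∉ window t ∧ t + 1 < (ρ : ℂ).im) :
    ∑ ρ ∈ S, |farTerm t ρ| ≤ 9 * Real.log t + 45 := by
  classical
  have ht0 : 0 ≤ t := by linarith
  have hw : ∀ ρ ∈ S, |farTerm t ρ| ≤
      (riemannZetaZeroOrder (ρ : ℂ) : ℝ) * (3 / 2 / ((shellUp t ρ : ℕ) : ℝ) ^ 2) := by
    intro ρ hρ
    obtain ⟨hnot, hγ⟩ := hS ρ hρ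
    have hm0 : (0 : ℝ) ≤ riemannZetaZeroOrder (ρ : ℂ) := by
      exact_mod_cast riemannZetaZeroOrder_nonneg (ZetaZeros.riemannZetaNontrivialZeros.ne_one ρ.2)
    simp only [farTerm, hnot, ↓reduceIte, abs_mul, abs_of_nonneg hm0]
    exact mul_le_mul_of_nonneg_left (kernel_shellUp_bound hγ) hm0
  have hfib : ∀ n : ℕ, ∑ ρ ∈ S.filter (fun ρ => shellUp t ρ = n),
      (riemannZetaZeroOrder (ρ : ℂ) : ℝ) ≤ 3 * Real.log (t + n + 2) := by
    intro n
    have hn0 : (0 : ℝ) ≤ n := Nat.cast_nonneg n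
    have hmem : ∀ ρ ∈ S.filter (fun ρ => shellUp t ρ = n),
        t + n < (ρ : ℂ).im ∧ (ρ : ℂ).im ≤ t + n + 1 := by
      intro ρ hρ
      rw [Finset.mem_filter] at hρ
      obtain ⟨hρS, hρn⟩ := hρ
      obtain ⟨-, hlo, hhi⟩ := shellUp_spec (hS ρ hρS).2
      rw [hρn] at hlo hhi
      exact ⟨hlo, hhi⟩
    have hcount := sum_order_le_count_sub (T₁ := t + n) (T₂ := t + n + 1) (by linarith) (by linarith) _ hmem
    have hwin := zetaZeroCount_window_le_three_log (t + n)
    rw [abs_of_nonneg (by linarith : (0 : ℝ) ≤ t + n)] at hwin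
    linarith
  have hmain := finset_sum_le_shell_bound_mul S (shellUp t) (fun ρ => |farTerm t ρ|)
    (fun ρ => (riemannZetaZeroOrder (ρ : ℂ) : ℝ)) (fun n => 3 / 2 / (n : ℝ) ^ 2)
    (fun n => 3 * Real.log (t + n + 2)) (S.sup (shellUp t) + 1) hw (fun n => by positivity) hfib
    (shell_lt_sup_succ S (shellUp t))
  have hterm : ∀ n : ℕ, 3 * Real.log (t + n + 2) * (3 / 2 / (n : ℝ) ^ 2) =
      9 / 2 * (if n = 0 then (0 : ℝ) else Real.log (t + n + 2) / (n : ℝ) ^ 2) := by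
    intro n
    by_cases hn : n = 0
    · subst hn; simp
    · simp only [hn, ↓reduceIte]; ring
  have hrange : ∑ n ∈ Finset.range (S.sup (shellUp t) + 1),
      3 * Real.log (t + n + 2) * (3 / 2 / (n : ℝ) ^ 2) ≤ 9 / 2 * (2 * Real.log t + 10) := by
    rw [Finset.sum_congr rfl (fun n _ => hterm n), ← Finset.mul_sum]
    exact mul_le_mul_of_nonneg_left (sum_range_log_div_sq_le ht _) (by norm_num)
  linarith

/-! ## Lower range `0 ≤ γ ≤ t − 1`: floor shells -/

/-- Floor-shell facts below `t`: `n = shellIndex t ρ ≥ 1` and `t − n − 1 < γ ≤ t − n`. -/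
lemma shellIndex_spec_below {t : ℝ} {ρ : Zeros} (hγ : (ρ : ℂ).im ≤ t - 1) :
    1 ≤ shellIndex t ρ ∧ t - shellIndex t ρ - 1 < (ρ : ℂ).im ∧ (ρ : ℂ).im ≤ t - shellIndex t ρ := by
  have hpos : 0 ≤ t - (ρ : ℂ).im := by linarith
  have habs : |t - (ρ : ℂ).im| = t - (ρ : ℂ).im := abs_of_nonneg hpos
  have hfl := Nat.floor_le hpos
  have hlt := Nat.lt_floor_add_one (t - (ρ : ℂ).im)
  have hidx : shellIndex t ρ = ⌊t - (ρ : ℂ).im⌋₊ := by unfold shellIndex; rw [habs]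
  rw [hidx]
  refine ⟨Nat.le_floor ?_, ?_, ?_⟩
  · push_cast; linarith
  · linarith
  · linarith

/-- **Lower-range shell bound**: `∑_S |farTerm| ≤ 9 log t` when every `0 ≤ γ ≤ t − 1`. -/
lemma finset_sum_below_le {t : ℝ} (ht : 100 ≤ t) (S : Finset Zeros)
    (hS : ∀ ρ ∈ S, (ρ : ℂ) ∉ window t ∧ 0 ≤ (ρ : ℂ).im ∧ (ρ : ℂ).im ≤ t - 1) :
    ∑ ρ ∈ S, |farTerm t ρ| ≤ 9 * Real.log t := by
  classical
  have ht1 : 1 ≤ t := by linarith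
  have hlog : 0 ≤ Real.log t := Real.log_nonneg ht1
  have hw : ∀ ρ ∈ S, |farTerm t ρ| ≤
      (riemannZetaZeroOrder (ρ : ℂ) : ℝ) * (3 / 2 / ((shellIndex t ρ : ℕ) : ℝ) ^ 2) := by
    intro ρ hρ
    obtain ⟨hnot, -, hγ⟩ := hS ρ hρ
    have hm0 : (0 : ℝ) ≤ riemannZetaZeroOrder (ρ : ℂ) := by
      exact_mod_cast riemannZetaZeroOrder_nonneg (ZetaZeros.riemannZetaNontrivialZeros.ne_one ρ.2)
    simp only [farTerm, hnot, ↓reduceIte, abs_mul, abs_of_nonneg hm0]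
    exact mul_le_mul_of_nonneg_left
      (kernel_shell_bound (shellIndex_spec_below hγ).1 rfl) hm0
  have hfib : ∀ n : ℕ, ∑ ρ ∈ S.filter (fun ρ => shellIndex t ρ = n),
      (riemannZetaZeroOrder (ρ : ℂ) : ℝ) ≤ 3 * Real.log t := by
    intro n
    rcases (S.filter (fun ρ => shellIndex t ρ = n)).eq_empty_or_nonempty with hE | ⟨ρ₀, hρ₀⟩
    · rw [hE, Finset.sum_empty]; positivity
    have hmem : ∀ ρ ∈ S.filter (fun ρ => shellIndex t ρ = n),
        t - n - 1 < (ρ : ℂ).im ∧ (ρ : ℂ).im ≤ t - n := by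
      intro ρ hρ
      rw [Finset.mem_filter] at hρ
      obtain ⟨hρS, hρn⟩ := hρ
      obtain ⟨-, hlo, hhi⟩ := shellIndex_spec_below (hS ρ hρS).2.2
      rw [hρn] at hlo hhi
      exact ⟨hlo, hhi⟩
    -- the witness ρ₀ has γ₀ > 14, so the window (t − n − 1, t − n] sits above height 13
    have h14 := FordL33.fourteen_lt_abs_im ρ₀
    have hρ₀S : ρ₀ ∈ S := (Finset.mem_filter.mp hρ₀).1
    rw [abs_of_nonneg (hS ρ₀ hρ₀S).2.1] at h14
    have hγ₀ := (hmem ρ₀ hρ₀).2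
    have hT₁ : 13 < t - n - 1 := by linarith
    have hcount := sum_order_le_count_sub (T₁ := t - n - 1) (T₂ := t - n) (by linarith) (by linarith) _ hmem
    have hwin := zetaZeroCount_window_le_three_log (t - n - 1)
    rw [show t - (n : ℝ) - 1 + 1 = t - n by ring,
      abs_of_nonneg (by linarith : (0 : ℝ) ≤ t - n - 1)] at hwin
    have hn1 : 1 ≤ shellIndex t ρ₀ := (shellIndex_spec_below (hS ρ₀ hρ₀S).2.2).1
    rw [(Finset.mem_filter.mp hρ₀).2] at hn1
    have hn1' : (1 : ℝ) ≤ n := by exact_mod_cast hn1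
    have hlogmono : Real.log (t - n - 1 + 2) ≤ Real.log t :=
      Real.log_le_log (by linarith) (by linarith)
    linarith
  have hmain := finset_sum_le_shell_bound_mul S (shellIndex t) (fun ρ => |farTerm t ρ|)
    (fun ρ => (riemannZetaZeroOrder (ρ : ℂ) : ℝ)) (fun n => 3 / 2 / (n : ℝ) ^ 2)
    (fun _ => 3 * Real.log t) (S.sup (shellIndex t) + 1) hw (fun n => by positivity) hfib
    (shell_lt_sup_succ S (shellIndex t))
  have hterm : ∀ n : ℕ, 3 * Real.log t * (3 / 2 / (n : ℝ) ^ 2) =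
      9 / 2 * Real.log t * (1 / (n : ℝ) ^ 2) := fun n => by ring
  have hrange : ∑ n ∈ Finset.range (S.sup (shellIndex t) + 1), 3 * Real.log t * (3 / 2 / (n : ℝ) ^ 2) ≤
      9 / 2 * Real.log t * 2 := by
    rw [Finset.sum_congr rfl (fun n _ => hterm n), ← Finset.mul_sum]
    exact mul_le_mul_of_nonneg_left (sum_range_one_div_sq_le_two _) (by positivity)
  linarith

end StubFarField
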